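import Literature.Analysis.FunctionSpaces.BesselIKRealAxis
import HarnessLib

/-!
# The three-term recurrence of the Macdonald function, `K_{ν+1}(x) − K_{ν−1}(x) = (2ν/x) K_ν(x)`,
# for the tree's complex `besselK` and real `besselKReal`, with the derivative forms (DLMF 10.29.2)
# and the monotonicity of `K_ν(x)` in the order

Topic `Literature/Analysis/FunctionSpaces`, a proofs-only sibling of `BesselK.lean` / `BesselKPolya.lean`
/ `BesselIKRealAxis.lean` (no new definitions, no named facts).  Written by the typing seat
gridfusion-lit-3 (g6, 2026-08-27) because the MHD wall-factor file
`Literature/MathematicalPhysics/MHD/ScrewPinchWallFactor.lean` needs `Λ_∞ = m K_m/(m K_m + ζ K_{m−1})`,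
hence `Λ_∞ < 1` and `Λ_∞ → 1` (`ζ → 0⁺`), and the tree held only the companion relation
`K_ν' = −(K_{ν+1} + K_{ν−1})/2` (`hasDerivAt_besselKReal`, from Pólya's `G₁`).

## The printed statements (DLMF §10.29, §10.27, §10.32; `𝒵_ν = e^{νπi} K_ν`)
* (10.29.1) `𝒵_{ν−1}(z) − 𝒵_{ν+1}(z) = (2ν/z) 𝒵_ν(z)`, i.e. for `K`: `K_{ν+1}(z) − K_{ν−1}(z) = (2ν/z) K_ν(z)`
  — `besselK_succ_sub_pred` (complex order, real `z = x > 0`), `besselKReal_succ_sub_pred`.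
* (10.29.2) `K_ν'(z) = −K_{ν−1}(z) − (ν/z) K_ν(z) = −K_{ν+1}(z) + (ν/z) K_ν(z)` —
  `deriv_besselKReal_eq_pred`, `deriv_besselKReal_eq_succ`.
* (10.29.3) `K_0'(z) = −K_1(z)` — `deriv_besselKReal_zero`.
* (10.27.3) `K_{−ν}(z) = K_ν(z)` — `besselKReal_neg` (the complex `besselK_neg` is in `BesselK.lean`).
* From the representation (10.32.9) `K_ν(x) = ∫₀^∞ e^{−x cosh t} cosh(νt) dt` (the tree's DEFINITION of
  `besselKReal`): `K_μ(x) ≤ K_ν(x)` for `|μ| ≤ |ν|` and `<` for `|μ| < |ν|` (`x > 0`) —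
  `besselKReal_le_of_abs_le`, `besselKReal_lt_of_abs_lt`; hence `0 < x K_{ν−1}(x) …` bounds used by
  the MHD consumer: `two_mul_nu_lt` form `2ν K_ν(x) < x K_{ν+1}(x)` for `ν ≥ 0`
  (`two_nu_mul_besselKReal_lt`).

## Proof (integration by parts, as in Watson's derivation from the integral; here on Pólya's line integral)
With `k(t) = e^{−x cosh t}` and `c(t) = e^{νt}` the product `Ψ = k·c` is integrable on `ℝ` together with
`Ψ' = (ν − x sinh t) Ψ` (all exponential moments of `k` are finite, `PolyaBesselKernel.lean`), so
`∫_ℝ Ψ' = 0` (`integral_eq_zero_of_hasDerivAt_of_integrable`), i.e. `ν ∫ k e^{νt} = x ∫ k sinh t e^{νt}`;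
and `sinh t · e^{νt} = (e^{(ν+1)t} − e^{(ν−1)t})/2`.  Since `∫_ℝ k e^{μt} dt = 2K_μ(x)`
(`two_mul_besselK_eq_polyaG`, Bateman–Grosswald (2)), this is `2ν K_ν = x (K_{ν+1} − K_{ν−1})`.

## References
* [DLMF] NIST DLMF §10.27 (10.27.3), §10.29 (10.29.1–10.29.3), §10.32 (10.32.9).
* [BatemanGrosswald1964] §1 (2) (the line-integral representation, `BesselKPolya.lean`).
-/

noncomputable section

open MeasureTheory Set Real Complex Filter
open Literature.Analysis.Complex Literature.Analysis.Complex.Polya1926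

namespace Literature.Analysis.FunctionSpaces

/-! ## §1 The recurrence for the complex `besselK` (complex order, real positive argument) -/

/-- `sinh t · e^{iwt} = (e^{i w₊ t} − e^{i w₋ t})/2` with `i w± = i w ± 1`, written for Pólya's
exponent `I * w * t`. [folklore] -/
private theorem sinh_mul_cexp (w : ℂ) (t : ℝ) :
    (Real.sinh t : ℂ) * Complex.exp (I * w * t)
      = (Complex.exp (I * (w - I) * t) - Complex.exp (I * (w + I) * t)) / 2 := by
  have h2 := Complex.two_sinh (t : ℂ)
  have e1 : Complex.exp (I * (w - I) * t) = Complex.exp (I * w * t) * Complex.exp (t : ℂ) := by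
    rw [← Complex.exp_add]; congr 1; ring_nf; rw [Complex.I_sq]; ring
  have e2 : Complex.exp (I * (w + I) * t) = Complex.exp (I * w * t) * Complex.exp (-(t : ℂ)) := by
    rw [← Complex.exp_add]; congr 1; ring_nf; rw [Complex.I_sq]; ring
  rw [e1, e2, Complex.ofReal_sinh]
  linear_combination (Complex.exp (I * w * t) / 2) * h2

/-- **Pólya form of the recurrence**: `i w · 𝔊₀(x, w) = (x/2) (𝔊₀(x, w − i) − 𝔊₀(x, w + i))` (`x > 0`,
all complex `w`), by `∫_ℝ (k e^{iwt})' dt = 0`. [cite: DLMF, 10.29.1] -/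
theorem I_mul_polyaG_zero_eq {x : ℝ} (hx : 0 < x) (w : ℂ) :
    I * w * polyaG 0 x w = (x : ℂ) / 2 * (polyaG 0 x (w - I) - polyaG 0 x (w + I)) := by
  set c : ℝ → ℂ := fun t ↦ Complex.exp (I * w * t) with hc
  set Ψ : ℝ → ℂ := fun t ↦ (polyaKernel 0 x t : ℂ) * c t with hΨ
  set Ψ' : ℝ → ℂ := fun t ↦ I * w * ((polyaKernel 0 x t : ℂ) * c t)
      - (x : ℂ) * ((Real.sinh t : ℂ) * ((polyaKernel 0 x t : ℂ) * c t)) with hΨ'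
  -- derivative of `Ψ`
  have hderiv : ∀ t, HasDerivAt Ψ (Ψ' t) t := by
    intro t
    have h1 := (hasDerivAt_polyaKernel_zero_right x t).ofReal_comp
    have h2 : HasDerivAt c (Complex.exp (I * w * t) * (I * w)) t := by
      have h : HasDerivAt (fun s : ℝ ↦ I * w * (s : ℂ)) (I * w * 1) t := by
        simpa using ((hasDerivAt_id t).ofReal_comp).const_mul (I * w)
      simpa using h.cexp
    have h4 := h1.mul h2
    refine h4.congr_deriv ?_
    simp only [hΨ', hc]
    push_cast
    ring
  -- integrability of `Ψ` and `Ψ'`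
  have hi : Integrable Ψ := integrable_polyaKernel_mul_cexp hx 0 w
  have hsinh : Integrable fun t ↦ (Real.sinh t : ℂ) * ((polyaKernel 0 x t : ℂ) * c t) := by
    have hmaj := integrable_norm_polyaKernel_mul_exp hx 0 (‖w‖ + 1)
    refine hmaj.mono' (by simp only [hc]; fun_prop) (Eventually.of_forall fun t ↦ ?_)
    simp only [hc]
    rw [norm_mul, norm_mul, norm_polyaKernel, Complex.norm_real, Real.norm_eq_abs]
    have hk := polyaKernel_nonneg 0 x t
    calc |Real.sinh t| * (polyaKernel 0 x t * ‖Complex.exp (I * w * t)‖)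
        ≤ Real.exp |t| * (polyaKernel 0 x t * Real.exp (‖w‖ * |t|)) := by
          gcongr
          · exact abs_sinh_le_exp_abs t
          · exact norm_cexp_I_mul_mul_le w t
      _ = polyaKernel 0 x t * Real.exp ((‖w‖ + 1) * |t|) := by
          rw [add_mul (‖w‖) 1 |t|, Real.exp_add, one_mul]; ring
  have hΨ'i : Integrable Ψ' := (hi.const_mul _).sub (hsinh.const_mul _)
  -- `∫ Ψ' = 0`
  have h0 := integral_eq_zero_of_hasDerivAt_of_integrable hderiv hΨ'i hi
  -- evaluate `∫ Ψ'`
  have hsplit : ∀ t, (Real.sinh t : ℂ) * ((polyaKernel 0 x t : ℂ) * c t)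
      = ((polyaKernel 0 x t : ℂ) * Complex.exp (I * (w - I) * t)
          - (polyaKernel 0 x t : ℂ) * Complex.exp (I * (w + I) * t)) / 2 := by
    intro t
    simp only [hc]
    rw [← mul_assoc, mul_comm (Real.sinh t : ℂ), mul_assoc, sinh_mul_cexp w t]
    ring
  have hI1 := integrable_polyaKernel_mul_cexp hx 0 (w - I)
  have hI2 := integrable_polyaKernel_mul_cexp hx 0 (w + I)
  have hsinh_val : ∫ t, (Real.sinh t : ℂ) * ((polyaKernel 0 x t : ℂ) * c t)
      = (polyaG 0 x (w - I) - polyaG 0 x (w + I)) / 2 := by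
    rw [integral_congr_ae (Eventually.of_forall hsplit), integral_div, integral_sub hI1 hI2,
      polyaG_eq, polyaG_eq]
  have hG : ∫ t, Ψ t = polyaG 0 x w := by rw [polyaG_eq]
  have h5 : ∫ t, Ψ' t = I * w * polyaG 0 x w
      - (x : ℂ) * ((polyaG 0 x (w - I) - polyaG 0 x (w + I)) / 2) := by
    have e := integral_sub (hi.const_mul (I * w)) (hsinh.const_mul (x : ℂ))
    rw [integral_const_mul, integral_const_mul, hG, hsinh_val] at e
    exact e
  rw [h5] at h0
  linear_combination h0

/-- **`K_{ν+1}(x) − K_{ν−1}(x) = (2ν/x) K_ν(x)`** for every complex order `ν` and real `x > 0`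
(DLMF 10.29.1 for `𝒵_ν = e^{νπi}K_ν`). [cite: DLMF, 10.29.1] -/
theorem besselK_succ_sub_pred (ν : ℂ) {x : ℝ} (hx : 0 < x) :
    besselK (ν + 1) x - besselK (ν - 1) x = 2 * ν / x * besselK ν x := by
  have h := I_mul_polyaG_zero_eq hx (-I * ν)
  have e0 : polyaG 0 x (-I * ν) = 2 * besselK ν x := (two_mul_besselK_eq_polyaG hx ν).symm
  have e1 : polyaG 0 x (-I * ν - I) = 2 * besselK (ν + 1) x := by
    rw [show -I * ν - I = -I * (ν + 1) by ring]; exact (two_mul_besselK_eq_polyaG hx (ν + 1)).symm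
  have e2 : polyaG 0 x (-I * ν + I) = 2 * besselK (ν - 1) x := by
    rw [show -I * ν + I = -I * (ν - 1) by ring]; exact (two_mul_besselK_eq_polyaG hx (ν - 1)).symm
  rw [e0, e1, e2] at h
  have hI : I * (-I * ν) = ν := by rw [← mul_assoc, mul_neg, Complex.I_mul_I, neg_neg, one_mul]
  rw [hI] at h
  have hx0 : (x : ℂ) ≠ 0 := by exact_mod_cast hx.ne'
  rw [div_mul_eq_mul_div, eq_div_iff hx0]
  linear_combination (-1 : ℂ) * h

/-- `2ν K_ν(x) = x (K_{ν+1}(x) − K_{ν−1}(x))` (the recurrence cleared of the division).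
[cite: DLMF, 10.29.1] -/
theorem two_nu_mul_besselK (ν : ℂ) {x : ℝ} (hx : 0 < x) :
    2 * ν * besselK ν x = x * (besselK (ν + 1) x - besselK (ν - 1) x) := by
  rw [besselK_succ_sub_pred ν hx]
  have hx0 : (x : ℂ) ≠ 0 := by exact_mod_cast hx.ne'
  field_simp

/-! ## §2 The real `besselKReal`: recurrence, the two derivative forms, evenness in the order -/

/-- `K_{−ν}(x) = K_ν(x)` for the real function. [cite: DLMF, 10.27.3] -/
theorem besselKReal_neg (ν x : ℝ) : besselKReal (-ν) x = besselKReal ν x := by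
  unfold besselKReal
  simp [neg_mul, Real.cosh_neg]

/-- **`K_{ν+1}(x) − K_{ν−1}(x) = (2ν/x) K_ν(x)`** (real order, `x > 0`). [cite: DLMF, 10.29.1] -/
theorem besselKReal_succ_sub_pred (ν : ℝ) {x : ℝ} (hx : 0 < x) :
    besselKReal (ν + 1) x - besselKReal (ν - 1) x = 2 * ν / x * besselKReal ν x := by
  apply Complex.ofReal_injective
  have h := besselK_succ_sub_pred (ν : ℂ) hx
  have e1 : besselK ((ν : ℂ) + 1) (x : ℂ) = (besselKReal (ν + 1) x : ℂ) := by
    rw [ofReal_besselKReal]; push_cast; rfl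
  have e2 : besselK ((ν : ℂ) - 1) (x : ℂ) = (besselKReal (ν - 1) x : ℂ) := by
    rw [ofReal_besselKReal]; push_cast; rfl
  rw [e1, e2, ← ofReal_besselKReal] at h
  push_cast
  exact h

/-- `2ν K_ν(x) = x (K_{ν+1}(x) − K_{ν−1}(x))` (real). [cite: DLMF, 10.29.1] -/
theorem two_nu_mul_besselKReal (ν : ℝ) {x : ℝ} (hx : 0 < x) :
    2 * ν * besselKReal ν x = x * (besselKReal (ν + 1) x - besselKReal (ν - 1) x) := by
  rw [besselKReal_succ_sub_pred ν hx]
  field_simp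

/-- **`K_ν'(x) = −K_{ν−1}(x) − (ν/x) K_ν(x)`** (`x > 0`). [cite: DLMF, 10.29.2] -/
theorem deriv_besselKReal_eq_pred (ν : ℝ) {x : ℝ} (hx : 0 < x) :
    deriv (besselKReal ν) x = -besselKReal (ν - 1) x - ν / x * besselKReal ν x := by
  rw [deriv_besselKReal_eq ν hx]
  have h := besselKReal_succ_sub_pred ν hx
  have : besselKReal (ν + 1) x = besselKReal (ν - 1) x + 2 * ν / x * besselKReal ν x := by linarith
  rw [this]
  ring

/-- **`K_ν'(x) = −K_{ν+1}(x) + (ν/x) K_ν(x)`** (`x > 0`). [cite: DLMF, 10.29.2] -/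
theorem deriv_besselKReal_eq_succ (ν : ℝ) {x : ℝ} (hx : 0 < x) :
    deriv (besselKReal ν) x = -besselKReal (ν + 1) x + ν / x * besselKReal ν x := by
  rw [deriv_besselKReal_eq ν hx]
  have h := besselKReal_succ_sub_pred ν hx
  have : besselKReal (ν - 1) x = besselKReal (ν + 1) x - 2 * ν / x * besselKReal ν x := by linarith
  rw [this]
  ring

/-- `x K_ν'(x) = −x K_{ν−1}(x) − ν K_ν(x)` (`x > 0`). [cite: DLMF, 10.29.2] -/
theorem mul_deriv_besselKReal_eq_pred (ν : ℝ) {x : ℝ} (hx : 0 < x) :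
    x * deriv (besselKReal ν) x = -(x * besselKReal (ν - 1) x) - ν * besselKReal ν x := by
  rw [deriv_besselKReal_eq_pred ν hx]
  field_simp

/-- `x K_ν'(x) = −x K_{ν+1}(x) + ν K_ν(x)` (`x > 0`). [cite: DLMF, 10.29.2] -/
theorem mul_deriv_besselKReal_eq_succ (ν : ℝ) {x : ℝ} (hx : 0 < x) :
    x * deriv (besselKReal ν) x = -(x * besselKReal (ν + 1) x) + ν * besselKReal ν x := by
  rw [deriv_besselKReal_eq_succ ν hx]
  field_simp

/-- **`K_0'(x) = −K_1(x)`** (`x > 0`). [cite: DLMF, 10.29.3] -/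
theorem deriv_besselKReal_zero {x : ℝ} (hx : 0 < x) :
    deriv (besselKReal 0) x = -besselKReal 1 x := by
  rw [deriv_besselKReal_eq 0 hx, zero_add, zero_sub, besselKReal_neg]
  ring

/-- `(x K_1(x))' = −x K_0(x)` (`x > 0`): the `ν = 1` case of `(x^ν K_ν)' = −x^ν K_{ν−1}`.
[cite: DLMF, 10.29.4] -/
theorem hasDerivAt_mul_besselKReal_one {x : ℝ} (hx : 0 < x) :
    HasDerivAt (fun y => y * besselKReal 1 y) (-(x * besselKReal 0 x)) x := by
  have h := (hasDerivAt_id x).mul (hasDerivAt_besselKReal 1 hx)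
  refine h.congr_deriv ?_
  have h2 := mul_deriv_besselKReal_eq_pred 1 hx
  rw [deriv_besselKReal_eq 1 hx] at h2
  simp only [id, one_mul]
  norm_num at h2 ⊢
  linarith

/-! ## §3 Monotonicity of `K_ν(x)` in the order (read off the representation 10.32.9) -/

/-- The real integrand of (10.32.9) is integrable on `(0, ∞)` for `x > 0`. [folklore] -/
private theorem integrableOn_kernel_cosh (ν : ℝ) {x : ℝ} (hx : 0 < x) :
    IntegrableOn (fun t : ℝ => Real.exp (-x * Real.cosh t) * Real.cosh (ν * t)) (Ioi 0) := by
  have h := (integrable_besselKIntegrand (ν := (ν : ℂ)) (z := (x : ℂ)) (by simpa using hx)).norm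
  refine (h.congr ?_).integrableOn
  exact Filter.Eventually.of_forall fun t => by
    simp only []
    rw [besselKIntegrand_ofReal, Complex.norm_real, Real.norm_eq_abs,
      abs_of_nonneg (besselKIntegrand_re_nonneg ν x t)]

/-- **`K_ν(x)` is even and increasing in `|ν|`**: `K_μ(x) ≤ K_ν(x)` whenever `|μ| ≤ |ν|` (`x > 0`), since
`cosh(μt) ≤ cosh(νt)` in (10.32.9). [cite: DLMF, 10.32.9] -/
theorem besselKReal_le_of_abs_le {μ ν : ℝ} (h : |μ| ≤ |ν|) {x : ℝ} (hx : 0 < x) :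
    besselKReal μ x ≤ besselKReal ν x := by
  unfold besselKReal
  refine setIntegral_mono_on (integrableOn_kernel_cosh μ hx) (integrableOn_kernel_cosh ν hx)
    measurableSet_Ioi fun t ht => ?_
  have hcosh : Real.cosh (μ * t) ≤ Real.cosh (ν * t) := by
    rw [Real.cosh_le_cosh, abs_mul, abs_mul]
    exact mul_le_mul_of_nonneg_right h (abs_nonneg t)
  exact mul_le_mul_of_nonneg_left hcosh (Real.exp_pos _).le

/-- … and strictly: `K_μ(x) < K_ν(x)` whenever `|μ| < |ν|` (`x > 0`). [cite: DLMF, 10.32.9] -/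
theorem besselKReal_lt_of_abs_lt {μ ν : ℝ} (h : |μ| < |ν|) {x : ℝ} (hx : 0 < x) :
    besselKReal μ x < besselKReal ν x := by
  have hle := besselKReal_le_of_abs_le h.le hx
  -- the difference is the integral of a continuous function positive on `(0, ∞)`
  have hdiff : besselKReal ν x - besselKReal μ x
      = ∫ t in Ioi (0 : ℝ), Real.exp (-x * Real.cosh t) * (Real.cosh (ν * t) - Real.cosh (μ * t)) := by
    unfold besselKReal
    rw [← integral_sub (integrableOn_kernel_cosh ν hx) (integrableOn_kernel_cosh μ hx)]
    refine setIntegral_congr_fun measurableSet_Ioi fun t _ => ?_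
    ring
  have hint : IntegrableOn
      (fun t : ℝ => Real.exp (-x * Real.cosh t) * (Real.cosh (ν * t) - Real.cosh (μ * t))) (Ioi 0) := by
    have := (integrableOn_kernel_cosh ν hx).sub (integrableOn_kernel_cosh μ hx)
    refine this.congr_fun (fun t _ => ?_) measurableSet_Ioi
    simp only [Pi.sub_apply]; ring
  have hpos : ∀ t : ℝ, 0 < t →
      0 < Real.exp (-x * Real.cosh t) * (Real.cosh (ν * t) - Real.cosh (μ * t)) := by
    intro t ht
    refine mul_pos (Real.exp_pos _) (sub_pos.mpr ?_)
    rw [Real.cosh_lt_cosh, abs_mul, abs_mul]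
    exact mul_lt_mul_of_pos_right h (abs_pos.mpr ht.ne')
  have hnn : 0 ≤ᵐ[volume.restrict (Ioi (0 : ℝ))]
      (fun t : ℝ => Real.exp (-x * Real.cosh t) * (Real.cosh (ν * t) - Real.cosh (μ * t))) := by
    rw [EventuallyLE, ae_restrict_iff' measurableSet_Ioi]
    exact Filter.Eventually.of_forall fun t ht => (hpos t ht).le
  have hI : 0 < ∫ t in Ioi (0 : ℝ), Real.exp (-x * Real.cosh t) * (Real.cosh (ν * t) - Real.cosh (μ * t)) := by
    rw [setIntegral_pos_iff_support_of_nonneg_ae hnn hint]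
    have hsub : Ioi (0 : ℝ) ⊆ Function.support
        (fun t : ℝ => Real.exp (-x * Real.cosh t) * (Real.cosh (ν * t) - Real.cosh (μ * t))) ∩ Ioi 0 :=
      fun t ht => ⟨(hpos t ht).ne', ht⟩
    calc (0 : ENNReal) < volume (Ioi (0 : ℝ)) := by simp
      _ ≤ _ := measure_mono hsub
  linarith

/-- In particular `K_ν(x) ≤ K_{ν+1}(x)` for `ν ≥ −1/2` and `K_{ν−1}(x) ≤ K_ν(x)` for `ν ≥ 1/2` (`x > 0`).
[cite: DLMF, 10.32.9] -/
theorem besselKReal_le_succ {ν : ℝ} (hν : -1 / 2 ≤ ν) {x : ℝ} (hx : 0 < x) :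
    besselKReal ν x ≤ besselKReal (ν + 1) x := by
  refine besselKReal_le_of_abs_le ?_ hx
  rw [abs_le]
  have h1 : 0 < ν + 1 := by linarith
  rw [abs_of_pos h1]
  constructor <;> linarith [le_abs_self ν, neg_abs_le ν]

/-- **`2ν K_ν(x) < x K_{ν+1}(x)`** for `ν ≥ 0`, `x > 0` (from the recurrence and `K_{ν−1} > 0`); for the
MHD consumer this is `Λ_∞ < 1`. [cite: DLMF, 10.29.1] -/
theorem two_nu_mul_besselKReal_lt (ν : ℝ) {x : ℝ} (hx : 0 < x) :
    2 * ν * besselKReal ν x < x * besselKReal (ν + 1) x := by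
  rw [two_nu_mul_besselKReal ν hx]
  have := besselKReal_pos (ν - 1) hx
  nlinarith

/-- `x K_{ν+1}(x) ≤ 2ν K_ν(x) + x K_ν(x)` for `ν ≥ 1/2`, `x > 0` (the recurrence and `K_{ν−1} ≤ K_ν`);
for the MHD consumer this is `Λ_∞ ≥ ν/(ν + x)`. [cite: DLMF, 10.29.1] -/
theorem mul_besselKReal_succ_le {ν : ℝ} (hν : 1 / 2 ≤ ν) {x : ℝ} (hx : 0 < x) :
    x * besselKReal (ν + 1) x ≤ 2 * ν * besselKReal ν x + x * besselKReal ν x := by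
  rw [two_nu_mul_besselKReal ν hx]
  have h : besselKReal (ν - 1) x ≤ besselKReal ν x := by
    refine besselKReal_le_of_abs_le ?_ hx
    have h0 : 0 ≤ ν := by linarith
    rw [abs_of_nonneg h0, abs_le]
    constructor <;> linarith
  nlinarith

end Literature.Analysis.FunctionSpaces

end
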